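import Literature.AlgebraicGeometry.HodgeTheory.CyclicCoverBaseChart
import Literature.AlgebraicGeometry.Motives.ComplexPointsRegularMapNullImage
import HarnessLib

/-!
# The coefficient chart of the Carlson–Toledo base sends algebraic-chart-null sets to Lebesgue-null
# sets of coefficient vectors

Family `hodge`, layer `Literature/AlgebraicGeometry/HodgeTheory`. Theorems only (no definition, no named
fact). Companion of `CyclicCoverBaseChart` (the TOPOLOGICAL side: the coefficient chart
`χ : S(ℂ) → ℂ^{TernaryIndex p}`, `t ↦ (coeff_e f_t)_e`, of the base `S = cyclicCoverBase p` of the family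
`cyclicCoverFamily p` of cyclic covers `x₃^p = f(x₀,x₁,x₂)` is a topological embedding, so MEAGRE subsets of
`S(ℂ)` have meagre image) on the MEASURE side: `χ` is holomorphic for the atlas of algebraic charts of
`S(ℂ)` (its coordinates are, up to sign, affine coordinates of the morphism `S → U → 𝔸^{DegIndex 2 p}`),
so by `ComplexPoints.volume_image_algebraicChart_symm_image_eq_zero` every subset of `S(ℂ)` which, read
in an algebraic chart, is Lebesgue-null has LEBESGUE-NULL image in `ℂ^{TernaryIndex p}`.

* `coeffChart_eq_neg_affineCoords` — `coeff_e f_t = − x_{(e,0)}(t)`, the affine coordinate of index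
  `extendIndex e` of `t ↦ S → U → 𝔸^{DegIndex 2 p}`;
* `mdifferentiable_coeffChart_algebraicChart` — each coordinate of `χ` is `MDifferentiable` for the
  algebraic atlas `chartedSpaceOfCharts (algebraicChart S m) _`, `m = 0 + Nat.card (TernaryIndex p)`;
* `volume_image_coeffChart_algebraicChart_symm_image_eq_zero` — for every `t₁` and every Lebesgue-null
  `Z` inside the target of the algebraic chart at `t₁`: `volume (χ '' (chart⁻¹ '' Z)) = 0`;
* `volume_image_coeffChart_eq_zero_of_subset_iUnion` — countable-union form.

Written for prover-Ax's programme AE «ALMOST EVERY» (route `HodgeConjecture/CyclicUnitaryPowers`, cell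
`hodge-nonav`): the last step from «non-Hodge-generic points are chart-null» to «the exceptional set of
coefficient vectors is Lebesgue-null». Honest scope: transfer lemmas only; nothing here is about Hodge loci
or HC.

## References

* [SerreGAGA1956] J.-P. Serre, GAGA, Ann. Inst. Fourier 6 (1956), §2 n°5 Prop. 2, n°6.
* [Lee2012] J. M. Lee, Introduction to Smooth Manifolds, 2nd ed. (2012), Prop. 6.5.
* [CarlsonToledo1999] J. A. Carlson, D. Toledo, Discriminant complements and kernels of monodromy
  representations, Duke Math. J. 97 (1999), §2 (the universal family of cyclic covers).
-/

noncomputable section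

open MeasureTheory Set CategoryTheory MvPolynomial
open scoped Manifold ContDiff
open Literature.NumberTheory.Transcendental
open Literature.AlgebraicGeometry.Motives Literature.AlgebraicGeometry.Motives.UniversalHypersurface
open Literature.AlgebraicGeometry.HodgeTheory.UniversalHypersurface

namespace Literature.AlgebraicGeometry.HodgeTheory

variable (p : ℕ) [NeZero p]

/-- **`coeff_e f_t = − x_{(e,0)}(t)`**: the `e`-th coordinate of the coefficient chart is minus the affine
coordinate of index `extendIndex e` of the composite morphism `S = cyclicCoverBase p → U → 𝔸^{DegIndex 2 p}`
(`φ_p(a_{(e,0)}) = −b_e`, `cyclicCoverSpz_X_extendIndex`).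
[cite: CarlsonToledo1999, §2 (universalcyclic) (held text p0004)] -/
theorem coeffChart_eq_neg_affineCoords (t : ComplexPoints (cyclicCoverBase p)) (e : TernaryIndex p) :
    (branchForm p t).coeff e.1 =
      -AlgPoints.affineCoords (AlgPoints.map
        (toBaseSpz ℂ 2 p (cyclicCoverSpz p) ≫ baseToAffineSpace ℂ 2 p) t) (extendIndex e) := by
  rw [AlgPoints.map_comp_apply, affineCoords_map_baseToAffineSpace, coeffVector_apply,
    coeff_pointFormSpz, cyclicCoverSpz_X_extendIndex p (NeZero.ne p), map_neg, neg_neg, coeffChart_apply,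
    pointAlgHomSpz_apply]

/-- **The coordinates of the coefficient chart are holomorphic for the algebraic atlas of `S(ℂ)`**
(`m = 0 + Nat.card (TernaryIndex p)`, the relative dimension of `S → Spec ℂ` as recorded by
`smoothOfRelativeDimension_baseSpz_hom`). [cite: SerreGAGA1956, §2 n°5 Prop. 2 and n°6] -/
theorem mdifferentiable_coeffChart_algebraicChart (e : TernaryIndex p) :
    haveI := smoothOfRelativeDimension_baseSpz_hom ℂ 2 p (cyclicCoverSpz p)
    haveI := locallyOfFiniteType_baseSpz_hom ℂ 2 p (cyclicCoverSpz p)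
    letI := chartedSpaceOfCharts (ComplexPoints.algebraicChart (cyclicCoverBase p) (0 + Nat.card (TernaryIndex p)))
      (ComplexPoints.mem_algebraicChart_source (cyclicCoverBase p) (0 + Nat.card (TernaryIndex p)))
    MDifferentiable 𝓘(ℂ, Fin (0 + Nat.card (TernaryIndex p)) → ℂ) 𝓘(ℂ, ℂ)
      fun t : ComplexPoints (cyclicCoverBase p) ↦ (branchForm p t).coeff e.1 := by
  haveI := smoothOfRelativeDimension_baseSpz_hom ℂ 2 p (cyclicCoverSpz p)
  haveI := locallyOfFiniteType_baseSpz_hom ℂ 2 p (cyclicCoverSpz p)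
  letI := chartedSpaceOfCharts (ComplexPoints.algebraicChart (cyclicCoverBase p) (0 + Nat.card (TernaryIndex p)))
    (ComplexPoints.mem_algebraicChart_source (cyclicCoverBase p) (0 + Nat.card (TernaryIndex p)))
  have h := (ComplexPoints.mdifferentiable_affineCoords_algebraicChart (cyclicCoverBase p)
    (0 + Nat.card (TernaryIndex p)) (toBaseSpz ℂ 2 p (cyclicCoverSpz p) ≫ baseToAffineSpace ℂ 2 p)
    (extendIndex e)).neg
  have hfun : (fun t : ComplexPoints (cyclicCoverBase p) ↦ (branchForm p t).coeff e.1) =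
      -(fun t : ComplexPoints (cyclicCoverBase p) ↦ AlgPoints.affineCoords (AlgPoints.map
        (toBaseSpz ℂ 2 p (cyclicCoverSpz p) ≫ baseToAffineSpace ℂ 2 p) t) (extendIndex e)) := by
    funext t
    rw [Pi.neg_apply]
    exact coeffChart_eq_neg_affineCoords p t e
  rw [hfun]
  exact h

/-- **The coefficient chart sends algebraic-chart-null sets to Lebesgue-null sets of coefficient vectors.**
For every `t₁ ∈ S(ℂ)` and every `Z` inside the target of the algebraic chart at `t₁` with `volume Z = 0`:
the set of coefficient vectors `(coeff_e f_t)_e`, `t ∈ chart⁻¹(Z)`, is Lebesgue-null in `ℂ^{TernaryIndex p}`.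
[cite: Lee2012, Prop. 6.5] [cite: SerreGAGA1956, §2 n°5 Prop. 2 and n°6] -/
theorem volume_image_coeffChart_algebraicChart_symm_image_eq_zero (t₁ : ComplexPoints (cyclicCoverBase p))
    {Z : Set (Fin (0 + Nat.card (TernaryIndex p)) → ℂ)}
    (hZ : haveI := smoothOfRelativeDimension_baseSpz_hom ℂ 2 p (cyclicCoverSpz p)
      haveI := locallyOfFiniteType_baseSpz_hom ℂ 2 p (cyclicCoverSpz p)
      Z ⊆ (ComplexPoints.algebraicChart (cyclicCoverBase p) (0 + Nat.card (TernaryIndex p)) t₁).target)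
    (hZ0 : volume Z = 0) :
    haveI := smoothOfRelativeDimension_baseSpz_hom ℂ 2 p (cyclicCoverSpz p)
    haveI := locallyOfFiniteType_baseSpz_hom ℂ 2 p (cyclicCoverSpz p)
    volume ((fun t : ComplexPoints (cyclicCoverBase p) => fun e : TernaryIndex p => (branchForm p t).coeff e.1) ''
      ((ComplexPoints.algebraicChart (cyclicCoverBase p) (0 + Nat.card (TernaryIndex p)) t₁).symm '' Z)) = 0 := by
  haveI := smoothOfRelativeDimension_baseSpz_hom ℂ 2 p (cyclicCoverSpz p)
  haveI := locallyOfFiniteType_baseSpz_hom ℂ 2 p (cyclicCoverSpz p)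
  exact ComplexPoints.volume_image_algebraicChart_symm_image_eq_zero (cyclicCoverBase p)
    (0 + Nat.card (TernaryIndex p)) (by rw [zero_add, Nat.card_eq_fintype_card]) _
    (mdifferentiable_coeffChart_algebraicChart p) t₁ hZ hZ0

/-- **Countable-union form**: a subset `M ⊆ S(ℂ)` covered by countably many pieces `chart_{t n}⁻¹(Z n)` with
`volume (Z n) = 0` has a Lebesgue-null set of coefficient vectors. [cite: Lee2012, Prop. 6.5]
[cite: SerreGAGA1956, §2 n°5 Prop. 2 and n°6] -/
theorem volume_image_coeffChart_eq_zero_of_subset_iUnion {N : Type*} [Countable N]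
    (t : N → ComplexPoints (cyclicCoverBase p)) (Z : N → Set (Fin (0 + Nat.card (TernaryIndex p)) → ℂ))
    (hZ : haveI := smoothOfRelativeDimension_baseSpz_hom ℂ 2 p (cyclicCoverSpz p)
      haveI := locallyOfFiniteType_baseSpz_hom ℂ 2 p (cyclicCoverSpz p)
      ∀ n, Z n ⊆ (ComplexPoints.algebraicChart (cyclicCoverBase p) (0 + Nat.card (TernaryIndex p)) (t n)).target)
    (hZ0 : ∀ n, volume (Z n) = 0) {M : Set (ComplexPoints (cyclicCoverBase p))}
    (hM : haveI := smoothOfRelativeDimension_baseSpz_hom ℂ 2 p (cyclicCoverSpz p)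
      haveI := locallyOfFiniteType_baseSpz_hom ℂ 2 p (cyclicCoverSpz p)
      M ⊆ ⋃ n, (ComplexPoints.algebraicChart (cyclicCoverBase p) (0 + Nat.card (TernaryIndex p)) (t n)).symm '' Z n) :
    volume ((fun t : ComplexPoints (cyclicCoverBase p) => fun e : TernaryIndex p => (branchForm p t).coeff e.1) '' M)
      = 0 := by
  haveI := smoothOfRelativeDimension_baseSpz_hom ℂ 2 p (cyclicCoverSpz p)
  haveI := locallyOfFiniteType_baseSpz_hom ℂ 2 p (cyclicCoverSpz p)
  exact ComplexPoints.volume_image_eq_zero_of_subset_iUnion_algebraicChart_symm_image (cyclicCoverBase p)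
    (0 + Nat.card (TernaryIndex p)) (by rw [zero_add, Nat.card_eq_fintype_card]) _
    (mdifferentiable_coeffChart_algebraicChart p) t Z hZ hZ0 hM

end Literature.AlgebraicGeometry.HodgeTheory

end
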